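import Literature.NumberTheory.EllipticCurves.EllCurveTorsionGroupScheme
import Literature.NumberTheory.EllipticCurves.KugaSatoVarietyBaseChangeHom
import HarnessLib

/-!
# `E[N]` commutes with base change (on points)

Topic: `Literature/NumberTheory/EllipticCurves`. Complement to `EllCurveTorsionSubscheme.lean` /
`EllCurveTorsionGroupScheme.lean` (`E[N]` representing the `N`-torsion points) and to
`KugaSatoVarietyBaseChangeHom.lean` (a base change `G : E' → E` of elliptic curves over
`g : S' → S`, `EllCurveOver.IsBaseChangeVia`, pushes points forward multiplicatively:
`IsBaseChangeVia.push`, `pushMonoidHom`). Katz–Mazur (2.1)/(3.1): "formation of `E[N]` commutes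
with arbitrary base change" — for `E' = S' ×_S E` one has `E'[N] = S' ×_S E[N]`. This file proves
the statement on points (its Yoneda form), which is what level structures use:

* `IsBaseChangeVia.pushEquiv h X' : (X' ⟶ E') ≃ (X'|_S ⟶ E)` — **the points of `E'` over an
  `S'`-scheme `X'` are the points of `E` over `X'` regarded over `S`** (`f ↦ f ≫ G`; bijective by
  the cartesian square of `IsBaseChangeVia`), a group isomorphism `pushMulEquiv`;
* `IsBaseChangeVia.pushTorsion h X' N` — its restriction to `N`-torsion points,
  **`E'[N](X') ≃* {P ∈ E(X'|_S) | P^N = 1}`**, and, through the universal properties of `E'[N]`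
  and `E[N]` (`KugaSato.torsionPointsEquiv`), **`torsionHomEquiv h X' N :
  (X' ⟶ E'[N]) ≃ (X'|_S ⟶ E[N])`** — `E'[N]` represents the restriction to `S'`-schemes of the
  functor of points of `E[N]`, i.e. `E'[N] ≅ S' ×_S E[N]` in Yoneda form.

All proved; no named facts; nothing about finiteness.

## References

* N. Katz, B. Mazur, *Arithmetic moduli of elliptic curves* (1985), (2.1), (3.1).
  [KatzMazur1985]
* P. Deligne, *Formes modulaires et représentations ℓ-adiques*, Sém. Bourbaki 355 (1969), (3.6).
  [Deligne1971Bourbaki355]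
-/

universe u

open CategoryTheory Limits AlgebraicGeometry MonoidalCategory CartesianMonoidalCategory
open scoped MonObj

noncomputable section

namespace Literature.NumberTheory.EllipticCurves

namespace EllCurveOver.IsBaseChangeVia

variable {S S' : Scheme.{u}} {C : EllCurveOver S} {C' : EllCurveOver S'} {g : S' ⟶ S}
  {G : C'.E.left ⟶ C.E.left} (h : C'.IsBaseChangeVia C g G) (X' : Over S')

/-! ### Points of `E'` are points of `E` over `S'`-schemes -/

/-- `push` is injective: two points of `E'` with the same image in `E` agree (uniqueness in the
cartesian square `E' = S' ×_S E`). [cite: KatzMazur1985, (2.1)] -/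
theorem push_injective : Function.Injective (h.push X') := by
  intro f₁ f₂ hf
  have hl : f₁.left ≫ G = f₂.left ≫ G := by
    rw [← h.push_left X' f₁, ← h.push_left X' f₂, hf]
  ext
  exact h.isPullback.hom_ext hl (by rw [Over.w f₁, Over.w f₂])

/-- The point of `E'` over `X'` attached to a point `q` of `E` over `X'|_S` (existence in the
cartesian square `E' = S' ×_S E`). [cite: KatzMazur1985, (2.1)] -/
def pull (q : (Over.map g).obj X' ⟶ C.E) : X' ⟶ C'.E :=
  Over.homMk (h.isPullback.lift q.left X'.hom (Over.w q)) (h.isPullback.lift_snd _ _ _)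

/-- The underlying morphism of `pull q` composed with `G` is `q`. [folklore] -/
@[simp]
theorem pull_left_comp (q : (Over.map g).obj X' ⟶ C.E) : (h.pull X' q).left ≫ G = q.left :=
  h.isPullback.lift_fst _ _ _

/-- `push (pull q) = q`. [folklore] -/
@[simp]
theorem push_pull (q : (Over.map g).obj X' ⟶ C.E) : h.push X' (h.pull X' q) = q := by
  ext
  rw [push_left, pull_left_comp]

/-- `pull (push f) = f`. [folklore] -/
@[simp]
theorem pull_push (f : X' ⟶ C'.E) : h.pull X' (h.push X' f) = f :=
  h.push_injective X' (h.push_pull X' _)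

/-- **The points of `E'` over an `S'`-scheme `X'` are the points of `E` over `X'` regarded over
`S`**: `f ↦ f ≫ G` is a bijection `E'(X') ≃ E(X'|_S)` (the cartesian square of
`IsBaseChangeVia`; Katz–Mazur (2.1)). [cite: KatzMazur1985, (2.1)] -/
def pushEquiv : (X' ⟶ C'.E) ≃ ((Over.map g).obj X' ⟶ C.E) where
  toFun := h.push X'
  invFun := h.pull X'
  left_inv := h.pull_push X'
  right_inv := h.push_pull X'

/-- `pushEquiv` is `push`. [folklore] -/
@[simp]
theorem pushEquiv_apply (f : X' ⟶ C'.E) : h.pushEquiv X' f = h.push X' f :=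
  rfl

/-- **`E'(X') ≃* E(X'|_S)` as groups** (`push` is multiplicative, `pushMonoidHom`).
[cite: KatzMazur1985, (2.1)] -/
def pushMulEquiv : (X' ⟶ C'.E) ≃* ((Over.map g).obj X' ⟶ C.E) :=
  { h.pushEquiv X' with map_mul' := h.push_mul X' }

/-- `pushMulEquiv` is `push`. [folklore] -/
@[simp]
theorem pushMulEquiv_apply (f : X' ⟶ C'.E) : h.pushMulEquiv X' f = h.push X' f :=
  rfl

/-! ### `N`-torsion points and `E[N]` under base change -/

/-- `push` preserves and reflects `N`-torsion: `(f ≫ G)^N = 1 ↔ f^N = 1`. [folklore] -/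
theorem push_pow_eq_one_iff (f : X' ⟶ C'.E) (N : ℕ) : h.push X' f ^ N = 1 ↔ f ^ N = 1 := by
  rw [← h.push_pow, ← h.push_one X']
  exact (h.push_injective X').eq_iff

/-- **`E'[N]` represents the points of `E[N]` over `S'`-schemes**:
`(X' ⟶ E'[N]) ≃ (X'|_S ⟶ E[N])`, the Yoneda form of `E'[N] ≅ S' ×_S E[N]` (universal properties
of `E'[N]`, `E[N]` and `pushTorsion`; Katz–Mazur (3.1)). [cite: KatzMazur1985, (3.1)] -/
def torsionHomEquiv (N : ℕ) :
    (X' ⟶ KugaSato.torsion C'.E N) ≃ ((Over.map g).obj X' ⟶ KugaSato.torsion C.E N) :=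
  ((KugaSato.torsionPointsEquiv C'.E X' N).trans
      (Equiv.subtypeEquiv (h.pushEquiv X') fun f => (h.push_pow_eq_one_iff X' f N).symm)).trans
    (KugaSato.torsionPointsEquiv C.E ((Over.map g).obj X') N).symm

/-- `torsionHomEquiv f ≫ ι_E = push (f ≫ ι_{E'})`: the identification is the push-forward on the
underlying points of the curves. [folklore] -/
theorem torsionHomEquiv_comp_ι (N : ℕ) (f : X' ⟶ KugaSato.torsion C'.E N) :
    h.torsionHomEquiv X' N f ≫ KugaSato.torsionι C.E N =
      h.push X' (f ≫ KugaSato.torsionι C'.E N) :=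
  KugaSato.torsionLift_ι C.E N (h.push X' (f ≫ KugaSato.torsionι C'.E N))
    ((h.push_pow_eq_one_iff X' _ N).mpr (KugaSato.comp_torsionι_pow C'.E N f))

variable [IsCommMonObj C.E] [IsCommMonObj C'.E]

/-- **The `N`-torsion points of `E'` over `X'` are the `N`-torsion points of `E` over `X'|_S`**
(restriction of `pushMulEquiv`; Katz–Mazur (3.1): `E[N]` commutes with base change).
[cite: KatzMazur1985, (3.1)] -/
def pushTorsion (N : ℕ) :
    KugaSato.torsionPointsSubgroup C'.E X' N ≃*
      KugaSato.torsionPointsSubgroup C.E ((Over.map g).obj X') N where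
  toFun P := ⟨h.push X' P.1, (h.push_pow_eq_one_iff X' P.1 N).mpr P.2⟩
  invFun Q := ⟨h.pull X' Q.1, by
    have hQ : h.push X' (h.pull X' Q.1) ^ N = 1 := by rw [push_pull]; exact Q.2
    exact (h.push_pow_eq_one_iff X' _ N).mp hQ⟩
  left_inv P := Subtype.ext (h.pull_push X' P.1)
  right_inv Q := Subtype.ext (h.push_pull X' Q.1)
  map_mul' P Q := Subtype.ext (h.push_mul X' P.1 Q.1)

/-- Underlying point of `pushTorsion P`. [folklore] -/
@[simp]
theorem pushTorsion_apply_coe (N : ℕ) (P : KugaSato.torsionPointsSubgroup C'.E X' N) :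
    ((h.pushTorsion X' N P : KugaSato.torsionPointsSubgroup C.E ((Over.map g).obj X') N) :
      (Over.map g).obj X' ⟶ C.E) = h.push X' P.1 :=
  rfl

end EllCurveOver.IsBaseChangeVia

end Literature.NumberTheory.EllipticCurves

end
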